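import Summits.NavierStokesRegularity.NavierStokesRegularity.Theorems.StrainDoorsOneSliceLiouville
import Summits.NavierStokesRegularity.NavierStokesRegularity.Theorems.AdaptedFrequencyTangentFlowTransferAncientPressure
import HarnessLib

/-!
# StrainDoorsPeakClassLiouvilleIff — `PeakClassEmpty C₀` IS EQUIVALENT to the Type-I Liouville theorem with constant `C₀`

LEAD plate of the S-door lane (ns-s30-p1 g6; helper lane of `stmt-NavierStokesRegularity-0056`, rung N0;
`--supports stmt-NavierStokesRegularity-0056 --as helper`).  No new definitions; no sorry.

PART K (`StrainDoorsPeakDoors`) proves `PeakClassEmpty C₀ →` every classical Type-I solution with constant `C₀` on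
`(−∞,0)` vanishes (`eq_zero_of_typeI_of_peakClassEmpty`).  This file proves the CONVERSE, so that the peak-door programme
is LOSSLESS: door K-δ `PeakClassEmpty C₀` is EQUIVALENT to the Type-I Liouville statement for classical solutions with
the same constant.  Mechanism: a tangent peak `(v, z̄)` shifted by `1/4` is a Type-I ancient MILD solution
(`IsTypeITangentPeak.isTypeIAncientMild_shift`, R65 N1), hence CLASSICAL with some pressure
(`exists_isClassicalNSSolutionOn_Iio_of_isTypeIAncientMild`), and keeps the Type-I SPACE–TIME decay with the same
constant (`√(1/4 − t) ≥ √(−t)`); the Liouville statement kills it, contradicting `ω̄_v(−1, z̄) ≠ 0`.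

* `IsTypeITangentPeak.hasTypeIDecay_shift` — `HasTypeIDecay C₀ (v(· − 1/4))`;
* `IsTypeITangentPeak.exists_classical_shift` — `∃ q, IsClassicalNSSolutionOn (Iio 0) 1 0 (v(· − 1/4)) q`;
* ★★ `peakClassEmpty_of_typeI_liouville`, ★★ `peakClassEmpty_iff_typeI_liouville`.

WHAT THIS IS NOT: an equivalence between two OPEN statements about a HYPOTHETICAL blow-up class; neither side is proved;
`0056` / `10661` / NS regularity are NOT proved.
[cite: KochNadirashviliSereginSverak2009, Thm 6.1, §6 (arXiv:0709.3599); GigaMiura2011, §2]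
-/

noncomputable section

open MeasureTheory Set Function Filter Metric Real InnerProductSpace
open _root_.Topology
open scoped ENNReal NNReal RealInnerProductSpace ContDiff
open Literature.Analysis Literature.Analysis.FluidPDE
open Literature.Analysis.FluidPDE.VorticityDirectionDynamics

set_option linter.dupNamespace false

namespace Summit.NavierStokesRegularity.NavierStokesRegularity.Theorems.StrainDoors

/-- The shift `v(· − 1/4)` of a Type-I tangent peak keeps the Type-I space–time decay with the SAME constant on `(−∞,0)`
(`√(1/4 − t) ≥ √(−t)`). [folklore bookkeeping] -/
theorem IsTypeITangentPeak.hasTypeIDecay_shift {C₀ : ℝ}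
    {v : ℝ → EuclideanSpace ℝ (Fin 3) → EuclideanSpace ℝ (Fin 3)} {zbar : EuclideanSpace ℝ (Fin 3)}
    (h : IsTypeITangentPeak C₀ v zbar) : HasTypeIDecay C₀ (fun t => v (t - 1 / 4)) := by
  intro t ht x
  have hC₀ : 0 ≤ C₀ := by
    have h1 := h.2.1 (-1) (by norm_num) 0
    rw [norm_zero, zero_add, neg_neg, Real.sqrt_one, div_one] at h1
    exact (norm_nonneg _).trans h1
  have hd := h.2.1 (t - 1 / 4) (by linarith) x
  have hs : √(-t) ≤ √(-(t - 1 / 4)) := Real.sqrt_le_sqrt (by linarith)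
  have hpos : 0 < ‖x‖ + √(-t) := by
    have : 0 < √(-t) := Real.sqrt_pos.mpr (by linarith)
    positivity
  exact hd.trans (div_le_div_of_nonneg_left hC₀ hpos (by linarith))

/-- **A Type-I tangent peak is a CLASSICAL Type-I solution after the shift**: for `(v, z̄)` in the class there is a pressure
`q` with `IsClassicalNSSolutionOn (Iio 0) 1 0 (v(· − 1/4)) q` (the shift is in `A_{C₀}` by R65 N1, and members of `A_{C₀}`
carry a classical pressure, `exists_isClassicalNSSolutionOn_Iio_of_isTypeIAncientMild`). [tree composition] -/
theorem IsTypeITangentPeak.exists_classical_shift {C₀ : ℝ}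
    {v : ℝ → EuclideanSpace ℝ (Fin 3) → EuclideanSpace ℝ (Fin 3)} {zbar : EuclideanSpace ℝ (Fin 3)}
    (h : IsTypeITangentPeak C₀ v zbar) :
    ∃ q : ℝ → EuclideanSpace ℝ (Fin 3) → ℝ, IsClassicalNSSolutionOn (Iio 0) 1 0 (fun t => v (t - 1 / 4)) q :=
  Summit.NavierStokesRegularity.NavierStokesRegularity.Theorems.exists_isClassicalNSSolutionOn_Iio_of_isTypeIAncientMild
    h.isTypeIAncientMild_shift

/-- ★★ **THE TYPE-I LIOUVILLE THEOREM EMPTIES THE PEAK CLASS** (converse of PART K's `eq_zero_of_typeI_of_peakClassEmpty`):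
if every classical solution on `(−∞,0) × ℝ³` (`ν = 1`, `f = 0`) with Type-I decay of constant `C₀` vanishes identically,
then `PeakClassEmpty C₀`. [tree composition] -/
theorem peakClassEmpty_of_typeI_liouville {C₀ : ℝ}
    (hL : ∀ (u : ℝ → EuclideanSpace ℝ (Fin 3) → EuclideanSpace ℝ (Fin 3)) (p : ℝ → EuclideanSpace ℝ (Fin 3) → ℝ),
      IsClassicalNSSolutionOn (Iio 0) 1 0 u p → HasTypeIDecay C₀ u →
        ∀ t : ℝ, t < 0 → ∀ x : EuclideanSpace ℝ (Fin 3), u t x = 0) :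
    PeakClassEmpty C₀ := by
  intro v zbar h
  obtain ⟨q, hcl⟩ := h.exists_classical_shift
  have hzero := hL _ q hcl h.hasTypeIDecay_shift (-(3 / 4)) (by norm_num)
  have hslice : v (-1) = 0 := by
    funext y
    have h1 := hzero y
    simp only [show (-(3 / 4) : ℝ) - 1 / 4 = -1 by norm_num] at h1
    exact h1
  exact h.2.2.2.1 (by rw [hslice]; exact curl_zero zbar)

/-- ★★ **DOOR K-δ ⇔ TYPE-I LIOUVILLE (same constant)**: `PeakClassEmpty C₀` holds iff every classical Type-I solution
with constant `C₀` on `(−∞,0)` vanishes identically — the peak-door programme of PART K is lossless.  (Both sides OPEN.)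
[tree composition] -/
theorem peakClassEmpty_iff_typeI_liouville (C₀ : ℝ) :
    PeakClassEmpty C₀ ↔
      ∀ (u : ℝ → EuclideanSpace ℝ (Fin 3) → EuclideanSpace ℝ (Fin 3)) (p : ℝ → EuclideanSpace ℝ (Fin 3) → ℝ),
        IsClassicalNSSolutionOn (Iio 0) 1 0 u p → HasTypeIDecay C₀ u →
          ∀ t : ℝ, t < 0 → ∀ x : EuclideanSpace ℝ (Fin 3), u t x = 0 :=
  ⟨fun hE _ _ hsol hI => eq_zero_of_typeI_of_peakClassEmpty hE hsol hI, peakClassEmpty_of_typeI_liouville⟩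

end Summit.NavierStokesRegularity.NavierStokesRegularity.Theorems.StrainDoors

end
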